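import Summits.ResolutionOfSingularities.ResolutionOfSingularities.Theorems.EquisingularLiftEquisingularLiftNatNDChartBlowup
import HarnessLib

/-!
# [OURS · L1 W4.5(b) · EL♮(3)] ND CHART DICTIONARY (5/5) — `…NatNDChartFrame`: §12.9 (O1) the linear part `jac θ` of an origin-fixing coordinate change is invertible
# (`jac_symm_mul_jac`, `isUnit_det_jac`) and §12.10 every E1-legal centre lies OVER THE POINT for a convenient table (`exists_pos_of_bad`, `sum_ray_pos_of_bad`,
# `chartPull_X_mem_span_of_bad`)

OURS · L1 W4.5(b) · EL♮(3) stmt-ResolutionOfSingularities-20148 · counted 0 · AI-written (res-L1-w45b-idea-1 g22; landed in the text owner's lane by res-L1-w45b-lead-2 g6 on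
idea-1's OFFER R8-4), weaker than expert review; nothing of [Hironaka2017] asserted; no statement of the manuscript. Sorry-free, axioms standard, no instance, no
notation. `--supports stmt-ResolutionOfSingularities-20148 --as helper`: support module toward the registered 4th CHILD stub
`stub_elnat_three_isolated_newtonNondegenerate` (`IsoHypNDWon → ELNatConclusionO`, first unproved lemma `nd_rung_local`): this is the PROVED `k`-SIDE of that
rung's toric dictionary; the `O`-side plumbing (O1)–(O5) of `Cruxes/EquisingularLiftNatThree/NewtonNondegenerateRung.lean` §10.3 is untouched.
SOURCE = idea-1's companion `Cruxes/EquisingularLiftNatThree/NewtonNondegenerateRungCharts.lean` v4 sha16 391adf33f7303999 (1049 l., farm rc 0 · 0 sorries; §§12.1–12.6 = 54ad50e211ef87b7), bodies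
VERBATIM; tree home = namespace `…Cruxes.EquisingularLiftNat.Sections.ND` (text owner's ruling on R8-4), imports route-independent, prelude lemmas public, split by
the 400-line rule into `…NatNDChartPullback` (§12.1–§12.2) → `…NatNDChartEnd` (§12.3) → `…NatNDChartPlays` (§12.4–§12.6) → `…NatNDChartBlowup` (§12.7–§12.8) →
`…NatNDChartFrame` (§12.9–§12.10).
-/

noncomputable section

set_option linter.dupNamespace false

open MvPolynomial

namespace Summit.ResolutionOfSingularities.ResolutionOfSingularities.Cruxes.EquisingularLiftNat.Sections.ND

open Summit.ResolutionOfSingularities.ResolutionOfSingularities.Cruxes.EquisingularLiftNat.Sections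

variable {k : Type} [Field k] {N : ℕ} {n : ℕ}

/-! ### 12.9 (O1) kernel: the linear part of an origin-fixing coordinate change is invertible (PROVED)

For `θ : k[t] ≃ₐ[k] k[t]` with `FixesOrigin θ` (the coordinate change of `IsoHypNDWon`), the Jacobian matrix at the origin `jac θ = (∂θ(t_l)/∂t_j (0))_{l,j}` is
invertible: `jac θ.symm * jac θ = 1`.  Consequence for (O1): lifting the COEFFICIENTS of the `θ(t_l)` to `O` (`MvPolynomial.map π` is onto) gives `Θ_l ∈ O[t]` whose Jacobian
at the section is a unit of `𝒪_{𝔸ⁿ_O, a}` (its residue is `det (jac θ) ≠ 0`), so `(p, Θ₁, …, Θₙ)` is a regular system of parameters at `a` and `Θ : 𝔸ⁿ_O → 𝔸ⁿ_O` is étale at the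
section — the map along which the standard toric `O`-tower is pulled back (no automorphism of `O[t]` lifting `θ` is needed; none exists in general). -/

/-- The Jacobian matrix at the origin of an algebra endomorphism of `k[t₁,…,tₙ]`: `(jac θ) l j = ` the coefficient of `t_j` in `θ(t_l)`. -/
def jac (θ : MvPolynomial (Fin n) k →ₐ[k] MvPolynomial (Fin n) k) : Matrix (Fin n) (Fin n) k :=
  Matrix.of fun l j => coeff (Finsupp.single j 1) (θ (X l))

/-- An origin-fixing endomorphism preserves constant coefficients. -/
theorem constantCoeff_map_of_fixesOrigin (θ : MvPolynomial (Fin n) k →ₐ[k] MvPolynomial (Fin n) k) (hθ : ∀ l, constantCoeff (θ (X l)) = 0)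
    (q : MvPolynomial (Fin n) k) : constantCoeff (θ q) = constantCoeff q := by
  induction q using MvPolynomial.induction_on with
  | C a => rw [MvPolynomial.algHom_C, MvPolynomial.algebraMap_eq]
  | add p q hp hq => rw [map_add, map_add, map_add, hp, hq]
  | mul_X p l hp => rw [map_mul, map_mul, map_mul, hθ l, constantCoeff_X, mul_zero, mul_zero]

/-- `coeff 0 (r · t_l) = 0`. -/
theorem coeff_zero_mul_X (r : MvPolynomial (Fin n) k) (l : Fin n) : coeff (0 : Fin n →₀ ℕ) (r * X l) = 0 := by
  classical
  rw [coeff_mul_X']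
  simp

/-- `coeff t_j (r · t_l) = δ_{jl} · coeff 0 r`. -/
theorem coeff_single_mul_X (r : MvPolynomial (Fin n) k) (j l : Fin n) :
    coeff (Finsupp.single j 1) (r * X l) = if j = l then coeff (0 : Fin n →₀ ℕ) r else 0 := by
  classical
  rw [coeff_mul_X']
  by_cases h : j = l
  · subst h; rw [if_pos (by simp), if_pos rfl, tsub_self]
  · have hl : l ∉ (Finsupp.single j 1).support := by
      rw [Finsupp.mem_support_iff, Finsupp.single_apply, if_neg h]; exact fun h' => h' rfl
    rw [if_neg hl, if_neg h]

/-- Degree-one coefficients of a product (Leibniz at the origin): `coeff t_j (a r) = a(0) · coeff t_j r + coeff t_j a · r(0)`. -/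
theorem coeff_single_mul (a r : MvPolynomial (Fin n) k) (j : Fin n) :
    coeff (Finsupp.single j 1) (a * r) = coeff 0 a * coeff (Finsupp.single j 1) r + coeff (Finsupp.single j 1) a * coeff 0 r := by
  classical
  induction r using MvPolynomial.induction_on with
  | C c =>
    have hne : (0 : Fin n →₀ ℕ) ≠ Finsupp.single j 1 := by rw [ne_comm, Ne, Finsupp.single_eq_zero]; exact one_ne_zero
    rw [mul_comm, coeff_C_mul, coeff_C, coeff_C, if_neg hne, if_pos rfl]
    ring
  | add p q hp hq => rw [mul_add, coeff_add, hp, hq, coeff_add, coeff_add]; ring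
  | mul_X p l hp =>
    rw [← mul_assoc, coeff_single_mul_X, coeff_single_mul_X, coeff_zero_mul_X, mul_zero, add_zero]
    by_cases h : j = l
    · subst h; rw [if_pos rfl, if_pos rfl, ← constantCoeff_eq]; exact map_mul _ _ _
    · rw [if_neg h, if_neg h, mul_zero]

/-- **Chain rule at the origin, degree one**: the linear part of `θ q` is the linear part of `q` times the Jacobian of `θ` at `0` (for `θ` fixing the origin). -/
theorem coeff_single_map_of_fixesOrigin (θ : MvPolynomial (Fin n) k →ₐ[k] MvPolynomial (Fin n) k) (hθ : ∀ l, constantCoeff (θ (X l)) = 0)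
    (q : MvPolynomial (Fin n) k) (j : Fin n) :
    coeff (Finsupp.single j 1) (θ q) = ∑ l, coeff (Finsupp.single l 1) q * jac θ l j := by
  classical
  induction q using MvPolynomial.induction_on with
  | C a =>
    have hne : ∀ i : Fin n, (0 : Fin n →₀ ℕ) ≠ Finsupp.single i 1 := fun i => by rw [ne_comm, Ne, Finsupp.single_eq_zero]; exact one_ne_zero
    rw [MvPolynomial.algHom_C, MvPolynomial.algebraMap_eq, coeff_C, if_neg (hne j), eq_comm]
    refine Finset.sum_eq_zero fun l _ => ?_
    rw [coeff_C, if_neg (hne l), zero_mul]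
  | add p q hp hq =>
    rw [map_add, coeff_add, hp, hq, ← Finset.sum_add_distrib]
    refine Finset.sum_congr rfl fun l _ => ?_
    rw [coeff_add, add_mul]
  | mul_X p l₀ hp =>
    rw [map_mul, coeff_single_mul]
    have h0 : coeff (0 : Fin n →₀ ℕ) (θ (X l₀)) = 0 := by rw [← constantCoeff_eq]; exact hθ l₀
    have h0p : coeff (0 : Fin n →₀ ℕ) (θ p) = coeff (0 : Fin n →₀ ℕ) p := by
      rw [← constantCoeff_eq]; exact constantCoeff_map_of_fixesOrigin θ hθ p
    rw [h0, mul_zero, add_zero, h0p]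
    simp only [coeff_single_mul_X, ite_mul, zero_mul]
    rw [Finset.sum_ite_eq' Finset.univ l₀, if_pos (Finset.mem_univ _)]
    rfl

/-- **The Jacobian at the origin of an origin-fixing automorphism is invertible**: `jac θ⁻¹ · jac θ = 1`. -/
theorem jac_symm_mul_jac (θ : MvPolynomial (Fin n) k ≃ₐ[k] MvPolynomial (Fin n) k) (hθ : FixesOrigin θ) :
    jac (θ.symm : MvPolynomial (Fin n) k →ₐ[k] MvPolynomial (Fin n) k) * jac (θ : MvPolynomial (Fin n) k →ₐ[k] MvPolynomial (Fin n) k) = 1 := by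
  classical
  have hθ' : ∀ l, constantCoeff ((θ : MvPolynomial (Fin n) k →ₐ[k] MvPolynomial (Fin n) k) (X l)) = 0 := hθ
  ext l₀ j
  have h := coeff_single_map_of_fixesOrigin (θ : MvPolynomial (Fin n) k →ₐ[k] MvPolynomial (Fin n) k) hθ' (θ.symm (X l₀)) j
  have happ : (θ : MvPolynomial (Fin n) k →ₐ[k] MvPolynomial (Fin n) k) (θ.symm (X l₀)) = X l₀ := θ.apply_symm_apply (X l₀)
  have hX : coeff (Finsupp.single j 1) (X l₀ : MvPolynomial (Fin n) k) = if j = l₀ then 1 else 0 := by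
    rw [← one_mul (X l₀ : MvPolynomial (Fin n) k), coeff_single_mul_X, coeff_zero_one]
  rw [happ, hX] at h
  rw [Matrix.mul_apply, Matrix.one_apply]
  have hsum : (∑ l, jac (θ.symm : MvPolynomial (Fin n) k →ₐ[k] MvPolynomial (Fin n) k) l₀ l * jac (θ : MvPolynomial (Fin n) k →ₐ[k] MvPolynomial (Fin n) k) l j)
      = ∑ l, coeff (Finsupp.single l 1) (θ.symm (X l₀)) * jac (θ : MvPolynomial (Fin n) k →ₐ[k] MvPolynomial (Fin n) k) l j :=
    Finset.sum_congr rfl fun l _ => rfl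
  rw [hsum, ← h]
  by_cases hlj : l₀ = j
  · subst hlj; rfl
  · rw [if_neg hlj, if_neg (Ne.symm hlj)]

/-- The Jacobian at the origin of an origin-fixing polynomial automorphism has unit determinant. [OURS · ND chart dictionary, res-L1-w45b-idea-1 g22] -/
theorem isUnit_det_jac (θ : MvPolynomial (Fin n) k ≃ₐ[k] MvPolynomial (Fin n) k) (hθ : FixesOrigin θ) :
    IsUnit (jac (θ : MvPolynomial (Fin n) k →ₐ[k] MvPolynomial (Fin n) k)).det := by
  have h := congrArg Matrix.det (jac_symm_mul_jac θ hθ)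
  rw [Matrix.det_mul, Matrix.det_one, mul_comm] at h
  exact IsUnit.of_mul_eq_one _ h

/-! ### 12.10 (v4, crit-3 S-T26) Every E1-legal centre lies OVER THE POINT: `exists_pos_of_bad`, `chartPull_X_mem_span_of_bad`

In a natural chart `U_B` (rows `B j ∈ ℕⁿ`, §12.5: every chart of every play from `orthantFan n` is of this form) the torus-invariant centre of the star at the
face `J` is `Z_J = V(u_j : j ∈ J)`, and `π^*(t_l) = ∏_j u_j^{B_{jl}}` (`chartPull_eq_aeval`).  For a CONVENIENT table, `Bad` forces every coordinate `l` to be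
positive on some ray of the face (else the axis exponent `m·e_l ∈ V` is a common minimiser), hence every `π^*(t_l)` lies in the ideal of `Z_J`: the centre
maps to the point `t = 0`, i.e. to the chosen singular point `a` — at every stage, in every characteristic (the statement crit-3 asked to have BY NAME:
"every created ray strictly positive ⟹ every legal centre inside `π⁻¹(a)`"). -/

/-- A ray with non-negative entries pairs non-negatively with every exponent. [OURS · ND chart dictionary, res-L1-w45b-idea-1 g22] -/
theorem pair_nonneg_of_nonneg {ρ : Ray n} (hρ : ∀ l, 0 ≤ ρ l) (m : Fin n → ℕ) : 0 ≤ pair ρ m :=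
  Finset.sum_nonneg fun i _ => mul_nonneg (hρ i) (by exact_mod_cast Nat.zero_le _)

/-- `Bad` face of NON-NEGATIVE rays w.r.t. a CONVENIENT table ⟹ every coordinate is positive on some ray of the face. -/
theorem exists_pos_of_bad {V : Finset (Fin n → ℕ)} (hV : IsConvenientTable V) {τ : Finset (Ray n)} (hτ : ∀ ρ ∈ τ, ∀ l, 0 ≤ ρ l)
    (hB : Bad V τ) (l : Fin n) : ∃ ρ ∈ τ, 0 < ρ l := by
  by_contra hne
  have hle : ∀ ρ ∈ τ, ρ l ≤ 0 := fun ρ hρ => not_lt.1 fun h => hne ⟨ρ, hρ, h⟩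
  obtain ⟨-, hax⟩ := hV
  obtain ⟨v, hv, -, hv0⟩ := hax l
  apply hB
  refine ⟨v, hv, fun ρ hρ m' hm' => ?_⟩
  have hρl : ρ l = 0 := le_antisymm (hle ρ hρ) (hτ ρ hρ l)
  have hpv : pair ρ v = 0 := by
    unfold pair
    refine Finset.sum_eq_zero fun i _ => ?_
    by_cases hil : i = l
    · rw [hil, hρl, zero_mul]
    · rw [hv0 i hil, Nat.cast_zero, mul_zero]
  rw [hpv]; exact pair_nonneg_of_nonneg (hτ ρ hρ) m'

/-- The created ray `Σ_{ρ ∈ τ} ρ` of a legal star is STRICTLY POSITIVE. -/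
theorem sum_ray_pos_of_bad {V : Finset (Fin n → ℕ)} (hV : IsConvenientTable V) {τ : Finset (Ray n)} (hτ : ∀ ρ ∈ τ, ∀ l, 0 ≤ ρ l)
    (hB : Bad V τ) (l : Fin n) : 0 < (∑ ρ ∈ τ, ρ) l := by
  obtain ⟨ρ₀, hρ₀, hpos⟩ := exists_pos_of_bad hV hτ hB l
  rw [Finset.sum_apply]
  exact lt_of_lt_of_le hpos (Finset.single_le_sum (f := fun ρ => ρ l) (fun ρ hρ => hτ ρ hρ l) hρ₀)

/-- Chart form: in a natural chart `B`, a `Bad` face `J` (CONVENIENT table) has, for every coordinate `l`, a row `j ∈ J` with `B j l ≥ 1`. -/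
theorem exists_pos_of_bad_chart {V : Finset (Fin n → ℕ)} (hV : IsConvenientTable V) (B : Fin n → Fin n → ℕ) (J : Finset (Fin n))
    (hB : Bad V (J.image fun j => rayOf (B j))) (l : Fin n) : ∃ j ∈ J, 0 < B j l := by
  have hτ : ∀ ρ ∈ J.image (fun j => rayOf (B j)), ∀ l, 0 ≤ ρ l := by
    intro ρ hρ l'
    obtain ⟨j, -, rfl⟩ := Finset.mem_image.1 hρ
    show (0 : ℤ) ≤ ((B j l' : ℕ) : ℤ)
    exact_mod_cast Nat.zero_le _
  obtain ⟨ρ, hρ, hpos⟩ := exists_pos_of_bad hV hτ hB l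
  obtain ⟨j, hj, rfl⟩ := Finset.mem_image.1 hρ
  have hpos' : (0 : ℤ) < ((B j l : ℕ) : ℤ) := hpos
  exact ⟨j, hj, by exact_mod_cast hpos'⟩

/-- **Every E1-legal centre lies over the point.**  In the natural chart `B`, for a `Bad` face `J` of a CONVENIENT table, every base coordinate pulls back into
the ideal of the centre `Z_J = V(u_j : j ∈ J)`: `π^*(t_l) = ∏_i u_i^{B_{il}} ∈ (u_j : j ∈ J)` for all `l`. -/
theorem chartPull_X_mem_span_of_bad {V : Finset (Fin n → ℕ)} (hV : IsConvenientTable V) (B : Fin n → Fin n → ℕ) (J : Finset (Fin n))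
    (hB : Bad V (J.image fun j => rayOf (B j))) (l : Fin n) :
    chartPull B (X l : MvPolynomial (Fin n) k) ∈ Ideal.span ((fun j => (X j : MvPolynomial (Fin n) k)) '' (↑J : Set (Fin n))) := by
  classical
  obtain ⟨j₀, hj₀, hpos⟩ := exists_pos_of_bad_chart hV B J hB l
  rw [chartPull_eq_aeval, aeval_X, ← Finset.mul_prod_erase Finset.univ (fun i => (X i : MvPolynomial (Fin n) k) ^ B i l) (Finset.mem_univ j₀)]
  have hsplit : (X j₀ : MvPolynomial (Fin n) k) ^ B j₀ l = X j₀ * X j₀ ^ (B j₀ l - 1) := by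
    rw [← pow_succ', Nat.sub_add_cancel hpos]
  rw [hsplit, mul_assoc]
  exact Ideal.mul_mem_right _ _ (Ideal.subset_span ⟨j₀, Finset.mem_coe.2 hj₀, rfl⟩)

end Summit.ResolutionOfSingularities.ResolutionOfSingularities.Cruxes.EquisingularLiftNat.Sections.ND

end
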